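import Summits.RiemannHypothesis.RiemannHypothesis.Theorems.TiltedLandingLaw421R3FarStep2

/-! # TiltedLandingLaw421R3FarStep4 — W-08 RATE^B support: the NESTED STEP — the far step WITHOUT the far clause (C3 g38 RESULT-6 (T5), constant 4/5)
PART 4 of the far-step kit (C4 «kernel desk» rh-idea-6 g29, §F.9), against PART 2 `…R3FarStep2` (`normSq_pairQ`, `far_core_ineq`, `far_step_position`;
C4 g28 image b3316f46, betaR's hand) and the TREE module `…R3FarStep` (#1045).
THE POINT: at an UPPER point `w` that is NESTED in the pair's closed disc (`‖w − a‖ ≤ b`, = H-SIGN) and has bounded position-field (`2‖w − a‖ ≤ M‖q(w)‖`,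
= `|K(w)| ≤ M` at a critical point), the energy drop obeys the DICHOTOMY `min (4/5·b²) (4/5/M²) ≤ b² − Im w²` — with NO far clause `1 ≤ b|K|`:
on the far branch `‖q(w)‖ ≤ 2b‖w − a‖` this is part 2's `far_step_position`; on the WEAK branch `2b‖w − a‖ ≤ ‖q(w)‖` the position algebra gives
`5·Im w² ≤ b²` outright (`weak_core_ineq`: `0 ≤ t ≤ s ≤ B`, `4Bs ≤ (s+B)² − 4Bt` ⇒ `(B − t)² ≥ (B − s)² ≥ 4Bt` ⇒ `6Bt ≤ B² + t² ≤ B² + Bt` ⇒ `5t ≤ B`;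
C3's (T5) `core_weak` bounds `Im w²/b²` by `3 − 2√2 < 1/5`, so the drop constant is `4/5`, not `1/6`). ALOFT (`1/M ≤ b`, i.e. `s/η ≤ lowH` with `M = η/s`)
the minimum is the far value: ★★★ `nested_step_energy_eta`: `(4/5)·s² ≤ η²·(b² − Im w²)` = the `FarEnergyLawCQ (4/5)` summand of §B.10 from NESTED + `‖K(w)‖ ≤ η/s`
+ aloft alone; BELOW aloft (`b ≤ 1/M`) the height still contracts: `5·Im w² ≤ b²` (`nested_step_low_position`). Sharp position constant: `2√2 − 2 ≈ 0.828`
(critical configuration `K(w) = −i/b`, `w − a = i(√2 − 1)b`, `M = 1/b`), so `c = 1` (`FarEnergyLawQ`) is NOT a consequence of position geometry — it is the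
REAL-field value (`realField_far_energy`, #1045). SUPPORT for crux `TiltedLandingLaw421` (stmt-RiemannHypothesis-24774), `--supports … --as helper` only;
sorry-free. Nothing here bears on the truth of RH; RH is NOT proved; 24774 OPEN. -/

namespace RhW08.FarStep

open Complex Metric Set
open scoped ComplexConjugate
open RhW08.IsolatedTilt

/-! ## §F.9 THE NESTED STEP: H-SIGN + H-M ⟹ `min (4/5·b²) (4/5/M²) ≤ b² − Im w²` (no far clause); aloft ⟹ `(4/5)/M²` -/

/-- ★ (K) §F.9 **THE WEAK CORE INEQUALITY**: for `0 ≤ t ≤ s ≤ B`, `0 < B` and the WEAK clause `4Bs ≤ (s + B)² − 4Bt` (= `2b‖w − a‖ ≤ ‖q(w)‖` with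
`s = ‖w − a‖²`, `t = Im w²`, `B = b²`) one has `5t ≤ B`: the point sits at height `≤ b/√5`. -/
theorem weak_core_ineq {s t B : ℝ} (hB : 0 < B) (ht0 : 0 ≤ t) (hts : t ≤ s) (hsB : s ≤ B)
    (hweak : 4 * B * s ≤ (s + B) ^ 2 - 4 * B * t) : 5 * t ≤ B := by
  have h1 : 4 * B * t ≤ (B - s) ^ 2 := by nlinarith [hweak]
  have h2 : (B - s) ^ 2 ≤ (B - t) ^ 2 := by nlinarith [hts, hsB, ht0]
  have h3 : t ^ 2 ≤ B * t := by nlinarith [ht0, le_trans hts hsB]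
  nlinarith [h1, h2, h3, hB]

/-- ★ (K) §F.9 **THE WEAK STEP, POSITION FORM**: a point `w` NESTED in the closed disc (`‖w − a‖ ≤ b`) on the WEAK branch `2b·‖w − a‖ ≤ ‖q(w)‖`
(= `b·|K(w)| ≤ 1` at a critical point) has `5·Im w² ≤ b²`. No sign of `Im w` needed. -/
theorem weak_step_position {w : ℂ} {a b : ℝ} (hb : 0 < b)
    (hsign : ‖w - a‖ ≤ b) (hweak : 2 * b * ‖w - a‖ ≤ ‖pairQ a b w‖) : 5 * w.im ^ 2 ≤ b ^ 2 := by
  set s : ℝ := ‖w - (a : ℂ)‖ ^ 2 with hs_def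
  have hs_eq : s = (w.re - a) ^ 2 + w.im ^ 2 := by
    rw [hs_def, ← Complex.normSq_eq_norm_sq, Complex.normSq_apply, Complex.sub_re, Complex.sub_im, Complex.ofReal_re,
      Complex.ofReal_im, sub_zero]
    ring
  have hP : ‖pairQ a b w‖ ^ 2 = (s + b ^ 2) ^ 2 - 4 * b ^ 2 * w.im ^ 2 := by
    rw [← Complex.normSq_eq_norm_sq, normSq_pairQ, Complex.normSq_eq_norm_sq]
  have hts : w.im ^ 2 ≤ s := by rw [hs_eq]; nlinarith [sq_nonneg (w.re - a)]
  have ht0 : 0 ≤ w.im ^ 2 := sq_nonneg _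
  have hsB : s ≤ b ^ 2 := by
    rw [hs_def]
    have := mul_self_le_mul_self (norm_nonneg _) hsign
    nlinarith [this]
  have hweak2 : 4 * b ^ 2 * s ≤ (s + b ^ 2) ^ 2 - 4 * b ^ 2 * w.im ^ 2 := by
    rw [← hP, hs_def]
    have h0 : 0 ≤ 2 * b * ‖w - (a : ℂ)‖ := by positivity
    have := mul_self_le_mul_self h0 hweak
    nlinarith [this]
  have := weak_core_ineq (pow_pos hb 2) ht0 hts hsB hweak2
  linarith

/-- (K) §F.9 the weak step as an energy drop: `(4/5)·b² ≤ b² − Im w²`. -/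
theorem weak_step_drop {w : ℂ} {a b : ℝ} (hb : 0 < b)
    (hsign : ‖w - a‖ ≤ b) (hweak : 2 * b * ‖w - a‖ ≤ ‖pairQ a b w‖) : 4 / 5 * b ^ 2 ≤ b ^ 2 - w.im ^ 2 := by
  have := weak_step_position hb hsign hweak
  linarith

/-- ★★ (K) §F.9 **THE NESTED STEP** (dichotomy, C3 g38 (T5) «nested alone pays», constant corrected to `4/5`): an UPPER point NESTED in the closed disc with
bounded position-field `2‖w − a‖ ≤ M‖q(w)‖` satisfies `min (4/5·b²) (4/5/M²) ≤ b² − Im w²` — far branch by `far_step_position` (part 2), weak branch by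
`weak_step_drop`. NO far clause. -/
theorem nested_step_position {w : ℂ} {a b M : ℝ} (hb : 0 < b) (hw : 0 < w.im) (hM0 : 0 < M)
    (hsign : ‖w - a‖ ≤ b) (hM : 2 * ‖w - a‖ ≤ M * ‖pairQ a b w‖) :
    min (4 / 5 * b ^ 2) (4 / 5 / M ^ 2) ≤ b ^ 2 - w.im ^ 2 := by
  rcases le_total (‖pairQ a b w‖) (2 * b * ‖w - a‖) with hfar | hweak
  · exact le_trans (min_le_right _ _) (far_step_position hb hw hM0 hsign hfar hM)
  · exact le_trans (min_le_left _ _) (weak_step_drop hb hsign hweak)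

/-- ★★ (K) §F.9 **ALOFT** (`1/M ≤ b`): the minimum is the far value — `(4/5)/M² ≤ b² − Im w²` from H-SIGN + H-M + aloft, no far clause. -/
theorem nested_step_aloft_position {w : ℂ} {a b M : ℝ} (hb : 0 < b) (hw : 0 < w.im) (hM0 : 0 < M)
    (hsign : ‖w - a‖ ≤ b) (hM : 2 * ‖w - a‖ ≤ M * ‖pairQ a b w‖) (haloft : 1 / M ≤ b) :
    4 / 5 / M ^ 2 ≤ b ^ 2 - w.im ^ 2 := by
  have h := nested_step_position hb hw hM0 hsign hM
  have h3 : (1 / M) ^ 2 ≤ b ^ 2 := pow_le_pow_left₀ (by positivity) haloft 2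
  have h4 : 4 / 5 / M ^ 2 = 4 / 5 * (1 / M) ^ 2 := by field_simp
  have h5 : 4 / 5 / M ^ 2 ≤ 4 / 5 * b ^ 2 := by rw [h4]; nlinarith [h3]
  rwa [min_eq_right h5] at h

/-- (K) §F.9 **BELOW ALOFT** (`b ≤ 1/M`): the height still contracts by `√5` — `5·Im w² ≤ b²` (both branches). -/
theorem nested_step_low_position {w : ℂ} {a b M : ℝ} (hb : 0 < b) (hw : 0 < w.im) (hM0 : 0 < M)
    (hsign : ‖w - a‖ ≤ b) (hM : 2 * ‖w - a‖ ≤ M * ‖pairQ a b w‖) (hlow : b ≤ 1 / M) : 5 * w.im ^ 2 ≤ b ^ 2 := by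
  have h := nested_step_position hb hw hM0 hsign hM
  have h3 : b ^ 2 ≤ (1 / M) ^ 2 := pow_le_pow_left₀ hb.le hlow 2
  have h4 : 4 / 5 / M ^ 2 = 4 / 5 * (1 / M) ^ 2 := by field_simp
  have h5 : 4 / 5 * b ^ 2 ≤ 4 / 5 / M ^ 2 := by rw [h4]; nlinarith [h3]
  rw [min_eq_left h5] at h
  linarith

/-- ★★★ (K) §F.9 **THE NESTED STEP FOR betaR** (field form, frame-free; replaces the far clause `hK1` of `far_step_energy_of_field` by ALOFT):
`G = q·h` on `ball a ρ`, an UPPER critical point `w` of `G` in the ball with `h w ≠ 0`, NESTED `‖w − a‖ ≤ b`, field value `K := h′(w)/h(w)` with `‖K‖ ≤ M`,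
and `1/M ≤ b` ⇒ `(4/5)/M² ≤ b² − Im w²`. -/
theorem nested_step_energy_of_field {G h : ℂ → ℂ} {a b ρ M : ℝ} (hh : DifferentiableOn ℂ h (ball (a : ℂ) ρ))
    (hG : ∀ z ∈ ball (a : ℂ) ρ, G z = pairQ a b z * h z) {w : ℂ} (hw : w ∈ ball (a : ℂ) ρ) (hhw : h w ≠ 0)
    (hcrit : deriv G w = 0) (hb : 0 < b) (hwim : 0 < w.im) (hM0 : 0 < M) (hsign : ‖w - a‖ ≤ b)
    (hKM : ‖deriv h w / h w‖ ≤ M) (haloft : 1 / M ≤ b) :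
    4 / 5 / M ^ 2 ≤ b ^ 2 - w.im ^ 2 := by
  have hid := crit_field_identity hh hG hw hhw hcrit
  have hn : ‖pairQ a b w‖ * ‖deriv h w / h w‖ = 2 * ‖w - a‖ := by
    rw [← norm_mul, hid, norm_neg, norm_mul, Complex.norm_ofNat]
  have hM : 2 * ‖w - a‖ ≤ M * ‖pairQ a b w‖ := by
    rw [← hn, mul_comm]
    exact mul_le_mul_of_nonneg_right hKM (norm_nonneg _)
  exact nested_step_aloft_position hb hwim hM0 hsign hM haloft

/-- ★★★ (K) §F.9 … in the far-law currency `M = η/s`: NESTED + `‖K(w)‖ ≤ η/s` + ALOFT `s/η ≤ b` ⇒ `(4/5)·s² ≤ η²·(b² − Im w²)` —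
the `FarEnergyLawCQ (4/5)` summand (§B.10, `law421_of_energyLawC`) with NO far clause at the successor. -/
theorem nested_step_energy_eta {G h : ℂ → ℂ} {a b ρ η s : ℝ} (hh : DifferentiableOn ℂ h (ball (a : ℂ) ρ))
    (hG : ∀ z ∈ ball (a : ℂ) ρ, G z = pairQ a b z * h z) {w : ℂ} (hw : w ∈ ball (a : ℂ) ρ) (hhw : h w ≠ 0)
    (hcrit : deriv G w = 0) (hb : 0 < b) (hwim : 0 < w.im) (hη : 0 < η) (hs : 0 < s) (hsign : ‖w - a‖ ≤ b)
    (hKM : ‖deriv h w / h w‖ ≤ η / s) (haloft : s / η ≤ b) :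
    4 / 5 * s ^ 2 ≤ η ^ 2 * (b ^ 2 - w.im ^ 2) := by
  have hal : 1 / (η / s) ≤ b := by rwa [one_div_div]
  have h1 := nested_step_energy_of_field hh hG hw hhw hcrit hb hwim (div_pos hη hs) hsign hKM hal
  have hηs : 4 / 5 / (η / s) ^ 2 = 4 / 5 * s ^ 2 / η ^ 2 := by field_simp
  rw [hηs, div_le_iff₀ (by positivity)] at h1
  linarith

/-- (K) §F.9 the DICHOTOMY in field form (no aloft): NESTED + `‖K(w)‖ ≤ η/s` ⇒ `(4/5)·s² ≤ η²·(b² − Im w²)` OR `5·Im w² ≤ b²` — aloft levels pay the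
`(s/η)²`-purse, low levels contract the height by `√5`. -/
theorem nested_step_dichotomy_eta {G h : ℂ → ℂ} {a b ρ η s : ℝ} (hh : DifferentiableOn ℂ h (ball (a : ℂ) ρ))
    (hG : ∀ z ∈ ball (a : ℂ) ρ, G z = pairQ a b z * h z) {w : ℂ} (hw : w ∈ ball (a : ℂ) ρ) (hhw : h w ≠ 0)
    (hcrit : deriv G w = 0) (hb : 0 < b) (hwim : 0 < w.im) (hη : 0 < η) (hs : 0 < s) (hsign : ‖w - a‖ ≤ b)
    (hKM : ‖deriv h w / h w‖ ≤ η / s) :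
    4 / 5 * s ^ 2 ≤ η ^ 2 * (b ^ 2 - w.im ^ 2) ∨ 5 * w.im ^ 2 ≤ b ^ 2 := by
  rcases le_total (s / η) b with hal | hlow
  · exact Or.inl (nested_step_energy_eta hh hG hw hhw hcrit hb hwim hη hs hsign hKM hal)
  · right
    have hid := crit_field_identity hh hG hw hhw hcrit
    have hn : ‖pairQ a b w‖ * ‖deriv h w / h w‖ = 2 * ‖w - a‖ := by
      rw [← norm_mul, hid, norm_neg, norm_mul, Complex.norm_ofNat]
    have hM : 2 * ‖w - a‖ ≤ η / s * ‖pairQ a b w‖ := by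
      rw [← hn, mul_comm]
      exact mul_le_mul_of_nonneg_right hKM (norm_nonneg _)
    have hlow' : b ≤ 1 / (η / s) := by rwa [one_div_div]
    exact nested_step_low_position hb hwim (div_pos hη hs) hsign hM hlow'

end RhW08.FarStep
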